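import Summits.CriticalPhenomena.PercolationContinuityZ3.Theorems.Transplant.CayleyVirtuallyNilpotentDichotomy
import Summits.CriticalPhenomena.PercolationContinuityZ3.Theorems.Transplant.AutZSqCriticalProbLtOne
import Summits.CriticalPhenomena.PercolationContinuityZ3.Theorems.Transplant.AutVirtuallyCyclicCriticalProbOne
import Mathlib.GroupTheory.Schreier
import HarnessLib

/-!
# The vertex-transitive VIRTUALLY NILPOTENT dichotomy (kernel, unconditional): for a transitive finite-stabiliser group of automorphisms with a
# finite-index nilpotent subgroup, `p_c(G) < 1 ⟺` the group is not virtually cyclic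

builds on p205010 (kernel theorem, internal audit signed; external expert review pending) — nothing in this file uses p205010; unconditional, no node.
Lane `prim-bschramm`, seat `prim-bschramm-p4` gen 22 (PART C3 of `P4-GENERAL.md` §44).  Helper file (`--supports stmt-CriticalPhenomena-4575 --as helper`).

THE POINT.  By Trofimov–Sabidussi every connected vertex-transitive graph of polynomial growth carries a TRANSITIVE group of automorphisms `A` with
FINITE stabilisers that is virtually nilpotent (Gromov); this file decides Conjecture 4's hypothesis on that class from the structure of `A` alone:
**`VirtNilpotentAut.criticalProb_lt_one_iff_not_virtuallyCyclic` — `G` connected, locally finite; `A` acting transitively by automorphisms with a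
finite vertex stabiliser; `N ≤ A` of finite index and nilpotent.  Then `p_c(G, v) < 1 ⟺ ¬ ∃ c, [A : ⟨c⟩] < ∞`.**  Assembly: `⟹` is
`AutVirtCyc.not_virtuallyCyclic_of_criticalProb_lt_one` (p379921); `⟸`: `A` is finitely generated by `S_A = {a | a • t ∈ N[t]}`
(`AutScaled.closure_genSet`), so `N` is (Schreier), `N` is not virtually cyclic (index multiplicativity), so `b₁(N) ≥ 2`
(`Nilpotent.virtuallyCyclic_iff_dependent`), so `ℤ² ≤ N ≤ A` (`NilPair.exists_commuting_independent_pair`), so `p_c(G) < 1`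
(`AutZSq.criticalProb_lt_one`, p379653).  Cayley form: `VirtNilpotent.criticalProb_lt_one_iff_not_virtuallyCyclic` (file `CayleyVirtuallyNilpotentDichotomy`).
[cite: BenjaminiSchramm1996, §2 Conj. 1; §2 (almost transitive graphs)] [cite: LyonsPeres2016, §7.4 Cor. 7.19; §7.9 (Trofimov 1984, Sabidussi 1964)]
-/

noncomputable section

namespace Summit.CriticalPhenomena.PercolationContinuityZ3.Theorems.Transplant
open SimpleGraph Literature.Probability.LatticeModels Literature.Probability.Percolation
open scoped Classical

namespace VirtNilpotentAut

variable {V : Type} {G : SimpleGraph V} [G.LocallyFinite] {A : Type} [Group A] [MulAction A V]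

/-- **THEOREM (the vertex-transitive virtually nilpotent dichotomy, kernel, unconditional).**  `A` transitive by automorphisms with a finite vertex
stabiliser on a connected locally finite `G`, `N ≤ A` a finite-index NILPOTENT subgroup: `p_c(G, v) < 1 ⟺ A` is not virtually cyclic.
[cite: BenjaminiSchramm1996, §2 Conj. 1; §2 (almost transitive graphs)] [cite: LyonsPeres2016, §7.4 Cor. 7.19; §7.9] -/
theorem criticalProb_lt_one_iff_not_virtuallyCyclic (hact : IsActionByAut G A) (hc : G.Connected) (t : V) (htr : ∀ v : V, ∃ a : A, a • t = v)
    (hfin : (MulAction.stabilizer A t : Set A).Finite) (N : Subgroup A) [N.FiniteIndex] [Group.IsNilpotent N] (v : V) :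
    criticalProb G v < 1 ↔ ¬ ∃ c : A, (Subgroup.zpowers c).FiniteIndex := by
  refine ⟨AutVirtCyc.not_virtuallyCyclic_of_criticalProb_lt_one hact hc t htr hfin, fun hnvc => ?_⟩
  haveI : Group.FG A := ⟨⟨AutScaled.genSet G t hfin, AutScaled.closure_genSet hact hc htr hfin⟩⟩
  haveI : Group.FG N := Subgroup.fg_of_index_ne_zero N
  obtain ⟨-, S, -, hS⟩ := Group.fg_iff'.1 (inferInstance : Group.FG N)
  have hN : ¬ ∃ c : N, (Subgroup.zpowers c).FiniteIndex := fun ⟨c, hc'⟩ =>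
    hnvc ⟨(c : A), VirtNilpotent.finiteIndex_zpowers_of_subgroup N c hc'⟩
  obtain ⟨x, y, hxy, hind⟩ := Nilpotent.exists_commuting_independent_pair_of_not_virtuallyCyclic S hS hN
  refine AutZSq.criticalProb_lt_one hact hc t htr hfin (a := (x : A)) (b := (y : A)) (congrArg Subtype.val hxy.eq) (fun m n h => hind m n ?_) v
  apply Subtype.ext
  rw [Subgroup.coe_mul, Subgroup.coe_zpow, Subgroup.coe_zpow, Subgroup.coe_one]
  exact h

/-- **… equivalently `p_c(G, v) = 1 ⟺ A` IS virtually cyclic.** [cite: BenjaminiSchramm1996, §2 Conj. 1] -/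
theorem criticalProb_eq_one_iff_virtuallyCyclic (hact : IsActionByAut G A) (hc : G.Connected) (t : V) (htr : ∀ v : V, ∃ a : A, a • t = v)
    (hfin : (MulAction.stabilizer A t : Set A).Finite) (N : Subgroup A) [N.FiniteIndex] [Group.IsNilpotent N] (v : V) :
    criticalProb G v = 1 ↔ ∃ c : A, (Subgroup.zpowers c).FiniteIndex := by
  have hle : criticalProb G v ≤ 1 := (criticalProb_mem_Icc _ _).2
  have h := criticalProb_lt_one_iff_not_virtuallyCyclic hact hc t htr hfin N v
  constructor
  · intro h1; by_contra hvc; exact absurd (h.2 hvc) (by rw [h1]; exact lt_irrefl 1)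
  · intro hvc; by_contra hne; exact h.1 (lt_of_le_of_ne hle hne) hvc

end VirtNilpotentAut

end Summit.CriticalPhenomena.PercolationContinuityZ3.Theorems.Transplant
end
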